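import Mathlib
import Summits.Ventures.HodgeRepro0.P5S4TransportBasic

/-!
# P5S4Transport — transport of an abstract CM configuration along a relabelling (Theorem A of
P5-Dim8Census-S4Equivariance-v1, combinatorial core), kernel-checked

Setting (P5-LowDimCensus Def 1.1, P5-RED-WEIL Def 10.8, P5-Dim8Census-v3.3 §1): a finite set `S` of points, a finite
set `T` of permutations of `S` (in the application the group `T`; closure under products is not needed for any
transport statement, so `T : Finset (Equiv.Perm S)`), a finite set `Φ ⊆ S` (the CM type) and finite sets `Δ ⊆ S`.
For a permutation `w` of `S` put `T' := w T w⁻¹` (`conjF w T`), `Φ' := wΦ`, `Δ' := wΔ` (`smulF w ·`). Certified, for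
EVERY `w` (the block-permutation hypotheses of the page enter only through `w ι = ι w` for the ι-flags):

* `balanced_transport`: `Δ` is a balanced `2p`-set for `(T, Φ)` iff `Δ'` is one for `(T', Φ')`;
* `primitive_transport`: likewise for primitive balanced sets (no proper nonempty balanced subset), and
  `primitiveEquiv`: the bijection `Δ ↦ wΔ` between the primitive balanced `2p`-sets of `(T, Φ)` and of `(T', Φ')`;
* `orbit_transport` / `card_orbit_transport`: `T'Δ' = w(TΔ)`, so `|O'| = |O|`;
* `stab_transport` / `card_stab_transport`: `Stab_{T'}(Δ') = w Stab_T(Δ) w⁻¹`;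
* `phi_transport`, `content_transport`, `HDelta_transport` / `card_HDelta_transport`: the induced types
  `φ_s = {t ∈ T : t s ∈ Φ}`, the content (multiset of induced types over `Δ`) and the multiset stabiliser
  `H_Δ = {h ∈ T : c(hΔ) = c(Δ)}` are transported by conjugation, so `|H_{Δ'}| = |H_Δ|` (and `|T'| = |T|`);
* `iota_mem_stab_transport`, `iota_mem_HDelta_transport`: for `ι` commuting with `w`, the ι-flags are unchanged;
* `hsizes_transport`: the multiset of the `Stab_T(Δ)`-orbit sizes of the points of `Δ` (which determines the
  H-partition) is unchanged;
* `row_transport`: the bundled row `(|O|, |Stab|, |H_Δ|, [ι ∈ Stab], [ι ∈ H_Δ], orbit sizes)` of an orbit is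
  unchanged (with `|Δ|` and `|T|` unchanged by `card_smulF` / `card_conjF`, so `p` and `[K_Δ:ℚ] = |T|/|H_Δ|` too).

NOT certified: the Kubota rank, the primitivity of block types (block systems), the transitivity of `T` on the
blocks — the remaining clauses of Theorem A (1)–(2) of the page (paper proofs there) — and nothing about the census
figures themselves.
-/

namespace HodgeRepro0.P5S4Transport

open Finset

variable {S : Type*}

section decEq

variable [DecidableEq S]

/-- `Δ` is a balanced `2p`-set for `(T, Φ)`: `|Δ| = 2p` and `|tΔ ∩ Φ| = p` for every `t ∈ T` (Def 1.1) -/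
def Balanced (T : Finset (Equiv.Perm S)) (Φ : Finset S) (p : ℕ) (Δ : Finset S) : Prop :=
  Δ.card = 2 * p ∧ ∀ t ∈ T, (smulF t Δ ∩ Φ).card = p

/-- TRANSPORT OF BALANCED SETS: `wΔ` is balanced for `(w T w⁻¹, wΦ)` iff `Δ` is balanced for `(T, Φ)` -/
theorem balanced_transport (w : Equiv.Perm S) (T : Finset (Equiv.Perm S)) (Φ : Finset S) (p : ℕ) (Δ : Finset S) :
    Balanced (conjF w T) (smulF w Φ) p (smulF w Δ) ↔ Balanced T Φ p Δ := by
  unfold Balanced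
  rw [card_smulF]
  refine and_congr Iff.rfl ?_
  constructor
  · intro h t ht
    have := h (w * t * w⁻¹) (conjF_mem ht)
    rw [← smulF_mul, show w * t * w⁻¹ * w = w * t by group, smulF_mul, ← smulF_inter, card_smulF] at this
    exact this
  · intro h t' ht'
    have e : t' = w * (w⁻¹ * t' * w) * w⁻¹ := by group
    have := h _ (mem_conjF.1 ht')
    rw [e, ← smulF_mul, show w * (w⁻¹ * t' * w) * w⁻¹ * w = w * (w⁻¹ * t' * w) by group, smulF_mul,
      ← smulF_inter, card_smulF]
    exact this

/-- primitive: balanced with no proper nonempty balanced subset (Def 1.1) -/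
def Primitive (T : Finset (Equiv.Perm S)) (Φ : Finset S) (p : ℕ) (Δ : Finset S) : Prop :=
  Balanced T Φ p Δ ∧ ∀ Δ₁, Δ₁ ⊂ Δ → Δ₁.Nonempty → ∀ q, ¬ Balanced T Φ q Δ₁

/-- TRANSPORT OF PRIMITIVE BALANCED SETS -/
theorem primitive_transport (w : Equiv.Perm S) (T : Finset (Equiv.Perm S)) (Φ : Finset S) (p : ℕ) (Δ : Finset S) :
    Primitive (conjF w T) (smulF w Φ) p (smulF w Δ) ↔ Primitive T Φ p Δ := by
  unfold Primitive
  rw [balanced_transport]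
  refine and_congr Iff.rfl ?_
  constructor
  · intro h Δ₁ h1 h2 q hb
    exact h (smulF w Δ₁) ((smulF_ssubset_smulF w).2 h1) ((smulF_nonempty w).2 h2) q
      ((balanced_transport w T Φ q Δ₁).2 hb)
  · intro h Δ₁' h1 h2 q hb
    rw [← smulF_inv_smulF w Δ₁'] at h1 h2 hb
    exact h _ ((smulF_ssubset_smulF w).1 h1) ((smulF_nonempty w).1 h2) q
      ((balanced_transport w T Φ q _).1 hb)

/-- THE BIJECTION of Theorem A (3): `Δ ↦ wΔ` identifies the primitive balanced `2p`-sets of `(T, Φ)` with those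
of `(T', Φ')` (inverse `Δ' ↦ w⁻¹Δ'`) -/
def primitiveEquiv (w : Equiv.Perm S) (T : Finset (Equiv.Perm S)) (Φ : Finset S) (p : ℕ) :
    {Δ : Finset S // Primitive T Φ p Δ} ≃ {Δ' : Finset S // Primitive (conjF w T) (smulF w Φ) p Δ'} where
  toFun := fun Δ => ⟨smulF w Δ.1, (primitive_transport w T Φ p Δ.1).2 Δ.2⟩
  invFun := fun Δ' => ⟨smulF w⁻¹ Δ'.1, by
    have h := Δ'.2
    rw [← smulF_inv_smulF w Δ'.1] at h
    exact (primitive_transport w T Φ p _).1 h⟩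
  left_inv := fun Δ => by
    apply Subtype.ext
    exact inv_smulF_smulF w Δ.1
  right_inv := fun Δ' => by
    apply Subtype.ext
    exact smulF_inv_smulF w Δ'.1

/-- the bijection is `Δ ↦ wΔ` -/
theorem primitiveEquiv_apply (w : Equiv.Perm S) (T : Finset (Equiv.Perm S)) (Φ : Finset S) (p : ℕ)
    (Δ : {Δ : Finset S // Primitive T Φ p Δ}) : (primitiveEquiv w T Φ p Δ).1 = smulF w Δ.1 := rfl

/-- the orbit `T Δ` -/
def orbit (T : Finset (Equiv.Perm S)) (Δ : Finset S) : Finset (Finset S) := T.image (fun t => smulF t Δ)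

/-- membership in the orbit -/
theorem mem_orbit {T : Finset (Equiv.Perm S)} {Δ X : Finset S} : X ∈ orbit T Δ ↔ ∃ t ∈ T, smulF t Δ = X := by
  simp [orbit]

/-- `(w T w⁻¹)(wΔ) = w (TΔ)`: the orbit is transported -/
theorem orbit_transport (w : Equiv.Perm S) (T : Finset (Equiv.Perm S)) (Δ : Finset S) :
    orbit (conjF w T) (smulF w Δ) = (orbit T Δ).image (smulF w) := by
  ext X
  simp only [mem_orbit, Finset.mem_image]
  constructor
  · rintro ⟨t', ht', rfl⟩
    refine ⟨smulF (w⁻¹ * t' * w) Δ, ⟨w⁻¹ * t' * w, mem_conjF.1 ht', rfl⟩, ?_⟩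
    rw [← smulF_mul, ← smulF_mul]
    congr 1
    group
  · rintro ⟨Y, ⟨t, ht, rfl⟩, rfl⟩
    refine ⟨w * t * w⁻¹, conjF_mem ht, ?_⟩
    rw [← smulF_mul, ← smulF_mul]
    congr 1
    group

/-- `|O'| = |O|` -/
theorem card_orbit_transport (w : Equiv.Perm S) (T : Finset (Equiv.Perm S)) (Δ : Finset S) :
    (orbit (conjF w T) (smulF w Δ)).card = (orbit T Δ).card := by
  rw [orbit_transport, Finset.card_image_of_injective _ (smulF_injective w)]

/-- the stabiliser `Stab_T(Δ)` -/
def stab (T : Finset (Equiv.Perm S)) (Δ : Finset S) : Finset (Equiv.Perm S) := T.filter (fun t => smulF t Δ = Δ)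

/-- membership in the stabiliser -/
theorem mem_stab {T : Finset (Equiv.Perm S)} {Δ : Finset S} {t : Equiv.Perm S} :
    t ∈ stab T Δ ↔ t ∈ T ∧ smulF t Δ = Δ := by
  simp [stab]

/-- `Stab_{w T w⁻¹}(wΔ) = w Stab_T(Δ) w⁻¹` -/
theorem stab_transport (w : Equiv.Perm S) (T : Finset (Equiv.Perm S)) (Δ : Finset S) :
    stab (conjF w T) (smulF w Δ) = (stab T Δ).map (cjE w) := by
  ext t'
  simp only [mem_stab, Finset.mem_map, cjE_apply]
  constructor
  · rintro ⟨ht', he⟩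
    refine ⟨w⁻¹ * t' * w, ⟨mem_conjF.1 ht', ?_⟩, by group⟩
    have h2 := congrArg (smulF w⁻¹) he
    rw [← smulF_mul, ← smulF_mul, ← smulF_mul, inv_mul_cancel, smulF_one] at h2
    exact h2
  · rintro ⟨t, ⟨ht, he⟩, rfl⟩
    refine ⟨conjF_mem ht, ?_⟩
    rw [← smulF_mul, show w * t * w⁻¹ * w = w * t by group, smulF_mul, he]

/-- `|Stab_{T'}(Δ')| = |Stab_T(Δ)|` -/
theorem card_stab_transport (w : Equiv.Perm S) (T : Finset (Equiv.Perm S)) (Δ : Finset S) :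
    (stab (conjF w T) (smulF w Δ)).card = (stab T Δ).card := by
  rw [stab_transport, Finset.card_map]


/-- the induced type `φ_s = {t ∈ T : t s ∈ Φ}` (Def 10.8) -/
def phi (T : Finset (Equiv.Perm S)) (Φ : Finset S) (s : S) : Finset (Equiv.Perm S) := T.filter (fun t => t s ∈ Φ)

/-- membership in the induced type -/
theorem mem_phi {T : Finset (Equiv.Perm S)} {Φ : Finset S} {s : S} {t : Equiv.Perm S} :
    t ∈ phi T Φ s ↔ t ∈ T ∧ t s ∈ Φ := by
  simp [phi]

/-- `φ'_{ws} = w φ_s w⁻¹`: the induced type of `ws` for `(T', Φ')` is the conjugate of that of `s` -/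
theorem phi_transport (w : Equiv.Perm S) (T : Finset (Equiv.Perm S)) (Φ : Finset S) (s : S) :
    phi (conjF w T) (smulF w Φ) (w s) = (phi T Φ s).map (cjE w) := by
  ext t'
  simp only [mem_phi, Finset.mem_map, cjE_apply]
  constructor
  · rintro ⟨ht', hs⟩
    refine ⟨w⁻¹ * t' * w, ⟨mem_conjF.1 ht', ?_⟩, by group⟩
    rw [mem_smulF] at hs
    simpa [Equiv.Perm.mul_apply] using hs
  · rintro ⟨t, ⟨ht, hs⟩, rfl⟩
    refine ⟨conjF_mem ht, ?_⟩
    rw [mem_smulF]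
    simpa [Equiv.Perm.mul_apply] using hs

/-- the content `c(Δ)` = the multiset of the induced types of the points of `Δ` (Def 10.8) -/
def content (T : Finset (Equiv.Perm S)) (Φ : Finset S) (Δ : Finset S) : Multiset (Finset (Equiv.Perm S)) :=
  Δ.val.map (phi T Φ)

/-- `c(wΔ) = w c(Δ) w⁻¹` elementwise -/
theorem content_transport (w : Equiv.Perm S) (T : Finset (Equiv.Perm S)) (Φ : Finset S) (Δ : Finset S) :
    content (conjF w T) (smulF w Φ) (smulF w Δ) = (content T Φ Δ).map (fun X => X.map (cjE w)) := by
  unfold content smulF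
  rw [Finset.map_val, Multiset.map_map, Multiset.map_map]
  congr 1
  funext s
  simp only [Function.comp, Equiv.coe_toEmbedding]
  exact phi_transport w T Φ s

/-- the ι-flag `ι ∈ Stab(Δ)` is unchanged by a relabelling commuting with `ι` -/
theorem iota_mem_stab_transport {w ι : Equiv.Perm S} (hι : w * ι = ι * w) (T : Finset (Equiv.Perm S))
    (Δ : Finset S) : ι ∈ stab (conjF w T) (smulF w Δ) ↔ ι ∈ stab T Δ := by
  rw [stab_transport, mem_map_cjE_iff_of_comm hι]

section fintype

variable [Fintype S]

/-- the multiset stabiliser `H_Δ = {h ∈ T : c(hΔ) = c(Δ)}` (Def 10.8) -/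
def HDelta (T : Finset (Equiv.Perm S)) (Φ : Finset S) (Δ : Finset S) : Finset (Equiv.Perm S) :=
  T.filter (fun h => content T Φ (smulF h Δ) = content T Φ Δ)

/-- membership in the multiset stabiliser -/
theorem mem_HDelta {T : Finset (Equiv.Perm S)} {Φ Δ : Finset S} {h : Equiv.Perm S} :
    h ∈ HDelta T Φ Δ ↔ h ∈ T ∧ content T Φ (smulF h Δ) = content T Φ Δ := by
  simp [HDelta]

/-- `H_{wΔ} = w H_Δ w⁻¹` -/
theorem HDelta_transport (w : Equiv.Perm S) (T : Finset (Equiv.Perm S)) (Φ : Finset S) (Δ : Finset S) :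
    HDelta (conjF w T) (smulF w Φ) (smulF w Δ) = (HDelta T Φ Δ).map (cjE w) := by
  ext h'
  simp only [mem_HDelta, Finset.mem_map, cjE_apply]
  constructor
  · rintro ⟨hh', he⟩
    refine ⟨w⁻¹ * h' * w, ⟨mem_conjF.1 hh', ?_⟩, by group⟩
    have e : smulF h' (smulF w Δ) = smulF w (smulF (w⁻¹ * h' * w) Δ) := by
      rw [← smulF_mul, ← smulF_mul]
      congr 1
      group
    rw [e, content_transport, content_transport] at he
    exact Multiset.map_injective (Finset.map_injective (cjE w)) he
  · rintro ⟨h, ⟨hh, he⟩, rfl⟩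
    refine ⟨conjF_mem hh, ?_⟩
    have e : smulF (w * h * w⁻¹) (smulF w Δ) = smulF w (smulF h Δ) := by
      rw [← smulF_mul, ← smulF_mul]
      congr 1
      group
    rw [e, content_transport, content_transport, he]

/-- `|H_{Δ'}| = |H_Δ|`, hence `[T':H_{Δ'}] = [T:H_Δ]` -/
theorem card_HDelta_transport (w : Equiv.Perm S) (T : Finset (Equiv.Perm S)) (Φ : Finset S) (Δ : Finset S) :
    (HDelta (conjF w T) (smulF w Φ) (smulF w Δ)).card = (HDelta T Φ Δ).card := by
  rw [HDelta_transport, Finset.card_map]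

/-- the ι-flag `ι ∈ H_Δ` is unchanged by a relabelling commuting with `ι` -/
theorem iota_mem_HDelta_transport {w ι : Equiv.Perm S} (hι : w * ι = ι * w) (T : Finset (Equiv.Perm S))
    (Φ Δ : Finset S) : ι ∈ HDelta (conjF w T) (smulF w Φ) (smulF w Δ) ↔ ι ∈ HDelta T Φ Δ := by
  rw [HDelta_transport, mem_map_cjE_iff_of_comm hι]

/-- the size of the `Stab_T(Δ)`-orbit of a point -/
def orbSize (T : Finset (Equiv.Perm S)) (Δ : Finset S) (x : S) : ℕ := ((stab T Δ).image (fun t => t x)).card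

/-- the multiset of the `Stab_T(Δ)`-orbit sizes of the points of `Δ` (it determines the H-partition: the number
of orbits of size `k` is the multiplicity of `k` divided by `k`) -/
def hsizes (T : Finset (Equiv.Perm S)) (Δ : Finset S) : Multiset ℕ := Δ.val.map (orbSize T Δ)

/-- the `Stab`-orbit size of `wx` in `wΔ` equals that of `x` in `Δ` -/
theorem orbSize_transport (w : Equiv.Perm S) (T : Finset (Equiv.Perm S)) (Δ : Finset S) (x : S) :
    orbSize (conjF w T) (smulF w Δ) (w x) = orbSize T Δ x := by
  unfold orbSize
  rw [stab_transport, Finset.map_eq_image, Finset.image_image]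
  have e : ((fun t : Equiv.Perm S => t (w x)) ∘ (cjE w)) = (fun t => w (t x)) := by
    funext t
    simp [cjE_apply, Equiv.Perm.mul_apply]
  have e2 : (stab T Δ).image (fun t => w (t x)) = ((stab T Δ).image (fun t => t x)).image w := by
    rw [Finset.image_image]
    rfl
  rw [e, e2]
  exact Finset.card_image_of_injective _ w.injective

/-- the multiset of orbit sizes (the H-partition) is unchanged -/
theorem hsizes_transport (w : Equiv.Perm S) (T : Finset (Equiv.Perm S)) (Δ : Finset S) :
    hsizes (conjF w T) (smulF w Δ) = hsizes T Δ := by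
  unfold hsizes smulF
  rw [Finset.map_val, Multiset.map_map]
  congr 1
  funext x
  simp only [Function.comp, Equiv.coe_toEmbedding]
  exact orbSize_transport w T Δ x


/-- the ROW of an orbit, as the census records it: `(|O|, |Stab_T(Δ)|, |H_Δ|, [ι ∈ Stab], [ι ∈ H_Δ], orbit sizes)`
(the codimension `p` is `|Δ|/2`, unchanged by `card_smulF`; `[K_Δ:ℚ] = |T|/|H_Δ|` with `|T' | = |T|` by `card_conjF`) -/
def row (ι : Equiv.Perm S) (T : Finset (Equiv.Perm S)) (Φ : Finset S) (Δ : Finset S) :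
    ℕ × ℕ × ℕ × Bool × Bool × Multiset ℕ :=
  ((orbit T Δ).card, (stab T Δ).card, (HDelta T Φ Δ).card, decide (ι ∈ stab T Δ), decide (ι ∈ HDelta T Φ Δ),
    hsizes T Δ)

/-- `row(O') = row(O)`: every recorded invariant of an orbit is unchanged by a relabelling commuting with `ι` -/
theorem row_transport {w ι : Equiv.Perm S} (hι : w * ι = ι * w) (T : Finset (Equiv.Perm S)) (Φ Δ : Finset S) :
    row ι (conjF w T) (smulF w Φ) (smulF w Δ) = row ι T Φ Δ := by
  unfold row
  rw [card_orbit_transport, card_stab_transport, card_HDelta_transport, hsizes_transport,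
    decide_eq_decide.2 (iota_mem_stab_transport hι T Δ), decide_eq_decide.2 (iota_mem_HDelta_transport hι T Φ Δ)]

end fintype

end decEq

end HodgeRepro0.P5S4Transport
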